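import Mathlib
import Summits.ValiantsHypothesis.ValiantsHypothesis.Theorems.ProofCarryingSymmetryRestorationQPPCLayoutComb
import Summits.ValiantsHypothesis.ValiantsHypothesis.Theorems.ProofCarryingSymmetryRestorationQPACConverse

/-!
# Route ProofCarryingSymmetry — crux `RestorationQP`, line `registered`: a symmetric circuit proves its own symmetry in `P_c`, in polynomial size

Necessity of the provability stub T′ (`stub_invarianceProvableQP'`), part 4c.  With the gate lines
of parts 4a–4b:

* `gateStep` — the gate line of any gate from those of its children, cost `K = 300·M·(|G|+2)³`;
* `real_stage` — induction over a topological numbering: all gate lines at once, cost `K·P`;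
* **`exists_piCircuit_pcProofs_of_isSymmetric`** — a `Γ`-symmetric Dawar–Wilsenach circuit on a
  finite gate type `G` (output index fixed by `Γ`) is computed by a Hrubeš–Tzameret circuit `C`
  (`layoutCircuit`, the circuit of `exists_piCircuit_of_isSymmetric`) of size `≤ |G|²(|G|+2)` such
  that, for every `γ ∈ Γ`, the invariance identity `C ∘ γ = C` has a `P_c` PROOF OF SIZE
  `≤ 310·(|G|+3)⁹` (and, as before, `(C ∘ γ)• ≡_AC C•`).

This is the formal NECESSITY of the line's provability stub: part 5 turns it into
`RestorationQP → InvarianceProvableQP` (T_gen).  Everything proved, no named facts.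
-/

-- single-problem summit: `Summit.ValiantsHypothesis.ValiantsHypothesis.…` is the namespace by design (D-0017)
set_option linter.dupNamespace false

noncomputable section

open scoped Classical

namespace Summit.ValiantsHypothesis.ValiantsHypothesis.Theorems

namespace PCR

open Literature.Computability.AlgebraicComplexity PICircuit ACStability

universe u v

variable {𝔽 : Type u} [CommRing 𝔽] {X : Type v} {Yo : Type*} {G : Type*} [Fintype G]
variable {D : LabelledArithCircuit 𝔽 X Yo G} {f : G → ℕ} {P : ℕ} {ρ : X → X} {π : Equiv.Perm G}

/-! ### One gate from its children -/

/-- Hypotheses on `(ρ, π)`: `π` maps children to children and transforms labels as the relabelling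
`ρ` (the shape of `LabelledArithCircuit.IsAutomorphismExtending`, for a bare map `ρ`). [folklore] -/
structure IsIso (D : LabelledArithCircuit 𝔽 X Yo G) (ρ : X → X) (π : Equiv.Perm G) : Prop where
  /-- wires to wires -/
  children : ∀ g, D.children (π g) = (D.children g).map π.toEmbedding
  /-- the input `x` goes to the input `ρ x` -/
  var : ∀ g x, D.label g = .var x → D.label (π g) = .var (ρ x)
  /-- constants are fixed -/
  const : ∀ g c, D.label g = .const c → D.label (π g) = .const c
  /-- `+` is preserved -/
  add : ∀ g, D.label g = .add → D.label (π g) = .add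
  /-- `×` is preserved -/
  mul : ∀ g, D.label g = .mul → D.label (π g) = .mul

omit [CommRing 𝔽] [Fintype G] in
/-- An automorphism extending a group element is an isomorphism for its relabelling. [folklore] -/
theorem isIso_of_isAutomorphismExtending {Γ : Type*} [Group Γ] [MulAction Γ X] [MulAction Γ Yo] {γ : Γ}
    (hπ : D.IsAutomorphismExtending γ π) : IsIso D (fun x => γ • x) π where
  children := hπ.children_apply
  var g x h := by rw [hπ.label_apply, h]; rfl
  const g c h := by rw [hπ.label_apply, h]; rfl
  add g h := by rw [hπ.label_apply, h]; rfl
  mul g h := by rw [hπ.label_apply, h]; rfl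

/-- **The gate step**: the gate line of `g` from the gate lines of its children, at cost
`K = 300·M·(|G|+2)³`. [folklore] -/
theorem gateStep {L : List (PICircuit 𝔽 X × PICircuit 𝔽 X)} {n : ℕ} (h : Real (pcSystem 𝔽 X) L n)
    (hf : Function.Injective f) (hmono : ∀ g h : G, h ∈ D.children g → f h < f g) (hP : ∀ g, f g < P)
    (hI : IsIso D ρ π) (g : G) (hkids : ∀ c ∈ D.children g, gateLine D f P ρ π c ∈ L)
    {M : ℕ} (hM1 : 3 * (layoutBody D f P).length + 7 ≤ M)
    (hM2 : Fintype.card G * ((layoutBody D f P).length + 2) ≤ M) :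
    Real (pcSystem 𝔽 X) (gateLine D f P ρ π g :: L) (n + 300 * M * (Fintype.card G + 2) ^ 3) := by
  have hpow : 1 ≤ (Fintype.card G + 2) ^ 3 := Nat.one_le_pow _ _ (by omega)
  have hMle : M ≤ M * (Fintype.card G + 2) ^ 3 := Nat.le_mul_of_pos_right _ hpow
  rcases hl : D.label g with x | c | _ | _
  · exact (gateLine_of_var h hf hP hl (hI.var g x hl) hM1).mono (List.Subset.refl _) (by nlinarith)
  · exact (gateLine_of_const h hf hP hl (hI.const g c hl) hM1).mono (List.Subset.refl _) (by nlinarith)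
  · have hg : ¬ (D.label g).IsInput := by rw [hl]; exact CircuitLabel.not_isInput_add
    have hπl : D.label (π g) = D.label g := by rw [hI.add g hl, hl]
    by_cases h1 : (D.children g).toList.length = 1
    · exact (gateLine_of_one h hf hmono hP hg h1 (hI.children g) hπl hkids hM1).mono (List.Subset.refl _)
        (by nlinarith)
    · have h2 : 2 ≤ (D.children g).toList.length := by
        have := one_le_length_toList_children (D := D) hg; omega
      exact (gateLine_of_comb h hmono (addKit 𝔽 X) Node.add (fun _ _ => rfl)
        (fun h' hn ha hb hM' => h'.unshareAdd hn ha hb hM')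
        (fun g' hl' h2' => getD_layoutBody_comb_first_add hf hP (hl'.trans hl) h2')
        (fun g' hl' k hk hkr => getD_layoutBody_comb_succ_add hf hP (hl'.trans hl) hk hkr)
        h2 (hI.children g) hπl hkids hM1 hM2).mono (List.Subset.refl _) (by nlinarith)
  · have hg : ¬ (D.label g).IsInput := by rw [hl]; exact CircuitLabel.not_isInput_mul
    have hπl : D.label (π g) = D.label g := by rw [hI.mul g hl, hl]
    by_cases h1 : (D.children g).toList.length = 1
    · exact (gateLine_of_one h hf hmono hP hg h1 (hI.children g) hπl hkids hM1).mono (List.Subset.refl _)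
        (by nlinarith)
    · have h2 : 2 ≤ (D.children g).toList.length := by
        have := one_le_length_toList_children (D := D) hg; omega
      exact (gateLine_of_comb h hmono (mulKit 𝔽 X) Node.mul (fun _ _ => rfl)
        (fun h' hn ha hb hM' => h'.unshareMul hn ha hb hM')
        (fun g' hl' h2' => getD_layoutBody_comb_first_mul hf hP (hl'.trans hl) h2')
        (fun g' hl' k hk hkr => getD_layoutBody_comb_succ_mul hf hP (hl'.trans hl) hk hkr)
        h2 (hI.children g) hπl hkids hM1 hM2).mono (List.Subset.refl _) (by nlinarith)

/-! ### All gates: induction over the numbering -/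

/-- The gate lines of the gates numbered below `p`. [folklore] -/
def stage (D : LabelledArithCircuit 𝔽 X Yo G) (f : G → ℕ) (P : ℕ) (ρ : X → X) (π : Equiv.Perm G) (p : ℕ) :
    List (PICircuit 𝔽 X × PICircuit 𝔽 X) :=
  ((Finset.univ.filter fun g => f g < p).toList).map (gateLine D f P ρ π)

/-- A gate numbered below `p` has its line in stage `p`. [folklore] -/
theorem mem_stage {p : ℕ} {g : G} (hg : f g < p) : gateLine D f P ρ π g ∈ stage D f P ρ π p :=
  List.mem_map_of_mem (Finset.mem_toList.2 (Finset.mem_filter.2 ⟨Finset.mem_univ _, hg⟩))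

/-- Stage `p + 1` is stage `p` plus (at most) the line of the gate numbered `p`. [folklore] -/
theorem stage_succ_subset {p : ℕ} :
    stage D f P ρ π (p + 1) ⊆ stage D f P ρ π p ∪ (Finset.univ.filter fun g => f g = p).toList.map (gateLine D f P ρ π) := by
  intro e he
  obtain ⟨g, hg, rfl⟩ := List.mem_map.1 he
  have hgp : f g < p + 1 := (Finset.mem_filter.1 (Finset.mem_toList.1 hg)).2
  rcases Nat.lt_succ_iff_lt_or_eq.1 hgp with hlt | heq
  · exact List.mem_union_iff.2 (Or.inl (mem_stage hlt))
  · exact List.mem_union_iff.2 (Or.inr (List.mem_map_of_mem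
      (Finset.mem_toList.2 (Finset.mem_filter.2 ⟨Finset.mem_univ _, heq⟩))))

/-- **All gate lines at once**: stage `p` is realized at cost `K·p`. [folklore] -/
theorem real_stage (hf : Function.Injective f) (hmono : ∀ g h : G, h ∈ D.children g → f h < f g) (hP : ∀ g, f g < P)
    (hI : IsIso D ρ π) {M : ℕ} (hM1 : 3 * (layoutBody D f P).length + 7 ≤ M)
    (hM2 : Fintype.card G * ((layoutBody D f P).length + 2) ≤ M) :
    ∀ p : ℕ, Real (pcSystem 𝔽 X) (stage D f P ρ π p) (300 * M * (Fintype.card G + 2) ^ 3 * p) := by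
  intro p
  induction p with
  | zero =>
    have : stage D f P ρ π 0 = [] := by simp [stage]
    rw [this]; exact real_nil
  | succ p ih =>
    by_cases hex : ∃ g, f g = p
    · obtain ⟨g, hg⟩ := hex
      have r := gateStep ih hf hmono hP hI g (fun c hc => mem_stage (by rw [← hg]; exact hmono g c hc)) hM1 hM2
      refine r.mono (fun e he => ?_) (by ring_nf; omega)
      rcases List.mem_union_iff.1 (stage_succ_subset (D := D) (P := P) (ρ := ρ) (π := π) he) with he | he
      · exact List.mem_cons_of_mem _ he
      · obtain ⟨g', hg', rfl⟩ := List.mem_map.1 he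
        have : g' = g := hf (((Finset.mem_filter.1 (Finset.mem_toList.1 hg')).2).trans hg.symm)
        subst this
        exact List.mem_cons_self
    · refine ih.mono (fun e he => ?_) (Nat.mul_le_mul_left _ (Nat.le_succ p))
      rcases List.mem_union_iff.1 (stage_succ_subset (D := D) (P := P) (ρ := ρ) (π := π) he) with he | he
      · exact he
      · obtain ⟨g', hg', rfl⟩ := List.mem_map.1 he
        exact absurd ⟨g', (Finset.mem_filter.1 (Finset.mem_toList.1 hg')).2⟩ hex

/-- **Every gate line is provable in polynomial size.** [folklore] -/
theorem provable_gateLine (hf : Function.Injective f) (hmono : ∀ g h : G, h ∈ D.children g → f h < f g)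
    (hP : ∀ g, f g < P) (hI : IsIso D ρ π) {M : ℕ} (hM1 : 3 * (layoutBody D f P).length + 7 ≤ M)
    (hM2 : Fintype.card G * ((layoutBody D f P).length + 2) ≤ M) (g : G) :
    HasPCProofOfSize (pre ((layoutBody D f P).map (Node.rename ρ)) (outPos f g))
      (pre (layoutBody D f P) (outPos f (π g))) (300 * M * (Fintype.card G + 2) ^ 3 * P + 4 * M) := by
  have r := real_stage hf hmono hP hI hM1 hM2 P
  have hp := r.provable (mem_stage (hP g))
  refine PISystem.Provable.mono hp ?_ fun _ => le_rfl
  have h1 := size_pre_le ((layoutBody D f P).map (Node.rename ρ)) (outPos f g)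
  have h2 := size_pre_le (layoutBody D f P) (outPos f (π g))
  rw [length_map_rename] at h1
  have : (pcSystem 𝔽 X).size (pre ((layoutBody D f P).map (Node.rename ρ)) (outPos f g)) +
      (pcSystem 𝔽 X).size (pre (layoutBody D f P) (outPos f (π g))) ≤ 2 * M := by simp only [pcSystem]; omega
  exact_mod_cast (by omega : 300 * M * (Fintype.card G + 2) ^ 3 * P +
    2 * ((pcSystem 𝔽 X).size (pre ((layoutBody D f P).map (Node.rename ρ)) (outPos f g)) +
      (pcSystem 𝔽 X).size (pre (layoutBody D f P) (outPos f (π g)))) ≤ 300 * M * (Fintype.card G + 2) ^ 3 * P + 4 * M)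

/-! ### The layout circuit of a symmetric circuit proves its own symmetry -/

/-- The straight-line layout of `D` with output the block output of the gate indexed `y`
(numbering `topKey`, `|G|²` blocks) — the circuit of `exists_piCircuit_of_isSymmetric`. [folklore] -/
def layoutCircuit (D : LabelledArithCircuit 𝔽 X Yo G) (y : Yo) : PICircuit 𝔽 X :=
  pre (layoutBody D (topKey D) (Fintype.card G * Fintype.card G)) (outPos (topKey D) (D.output y))

/-- Cost bookkeeping for the final bound. [folklore] -/
theorem arith_final (s : ℕ) :
    300 * ((s + 3) * (s * s * (s + 2) + 3)) * (s + 2) ^ 3 * (s * s) + 4 * ((s + 3) * (s * s * (s + 2) + 3)) ≤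
      310 * (s + 3) ^ 9 := by
  have h1 : s * s * (s + 2) + 3 ≤ (s + 3) ^ 3 := by ring_nf; nlinarith [sq_nonneg s]
  have h2 : (s + 3) * (s * s * (s + 2) + 3) ≤ (s + 3) ^ 4 := by
    calc (s + 3) * (s * s * (s + 2) + 3) ≤ (s + 3) * (s + 3) ^ 3 := Nat.mul_le_mul_left _ h1
      _ = (s + 3) ^ 4 := by ring
  have h3 : (s + 2) ^ 3 ≤ (s + 3) ^ 3 := Nat.pow_le_pow_left (by omega) 3
  have h4 : s * s ≤ (s + 3) ^ 2 := by nlinarith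
  have h5 : 300 * ((s + 3) * (s * s * (s + 2) + 3)) * (s + 2) ^ 3 * (s * s) ≤ 300 * (s + 3) ^ 4 * (s + 3) ^ 3 * (s + 3) ^ 2 := by
    gcongr
  have h6 : 300 * (s + 3) ^ 4 * (s + 3) ^ 3 * (s + 3) ^ 2 = 300 * (s + 3) ^ 9 := by ring
  have h7 : 4 * ((s + 3) * (s * s * (s + 2) + 3)) ≤ 4 * (s + 3) ^ 4 := Nat.mul_le_mul_left 4 h2
  have h8 : (s + 3) ^ 4 ≤ (s + 3) ^ 9 := Nat.pow_le_pow_right (by omega) (by norm_num)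
  omega

/-- **A symmetric circuit proves its own symmetry, in polynomial size** (necessity of the
provability stub T′/T_gen of crux `RestorationQP`).  A `Γ`-symmetric Dawar–Wilsenach circuit on a
finite gate type `G`, with output index fixed by `Γ`, is computed by the Hrubeš–Tzameret circuit
`layoutCircuit D y` of size `≤ |G|·|G|·(|G|+2)`, whose unfolding is the binarised output formula
(so its renamed unfoldings are AC-equivalent to it), and such that for every `γ ∈ Γ` the invariance
identity `C ∘ γ = C` has a `P_c` proof of size `≤ 310·(|G|+3)⁹`. [folklore] -/
theorem exists_piCircuit_pcProofs_of_isSymmetric {Γ : Type*} [Group Γ] [MulAction Γ X] [MulAction Γ Yo]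
    (D : LabelledArithCircuit 𝔽 X Yo G) (hD : D.IsSymmetric Γ) (y : Yo) (hy : ∀ γ : Γ, γ • y = y) :
    ∃ C : PICircuit 𝔽 X, C.unfold = binTree D (D.output y) ∧ C.eval = D.eval (D.output y) ∧
      C.size ≤ Fintype.card G * Fintype.card G * (Fintype.card G + 2) ∧
      (∀ γ : Γ, ACEq (C.rename fun x => γ • x).unfold C.unfold) ∧
      ∀ γ : Γ, HasPCProofOfSize (C.rename fun x => γ • x) C (310 * (Fintype.card G + 3) ^ 9) := by
  set s := Fintype.card G with hs
  set f := topKey D with hf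
  set P := s * s with hP
  set B := layoutBody D f P with hB
  set u := outPos f (D.output y) with hu
  have hfi : Function.Injective f := topKey_injective D
  have hmono : ∀ g h : G, h ∈ D.children g → f h < f g := fun g h hh => topKey_lt_of_mem_children D hh
  have hPl : ∀ g, f g < P := topKey_lt D
  have hunf : (pre B u).unfold = binTree D (D.output y) := by
    have h1 := getD_unfoldList_eq_unfold_prefixAt B (.const 0) u
    have h2 := getD_unfoldList_layoutBody_outPos (D := D) hfi hmono (P := P) hPl (D.output y)
    rw [h1] at h2
    exact h2
  refine ⟨pre B u, hunf, ?_, ?_, ?_, ?_⟩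
  · change PIFormula.eval (PICircuit.unfold _) = _
    rw [hunf, eval_binTree]
  · have hBl : B.length = P * bl (G := G) := length_layoutBody P
    have hb : bl (G := G) = s + 2 := rfl
    have hlt : u < P * bl (G := G) := by rw [hu, outPos_eq]; exact block_index_lt hPl _ (by rw [hb]; omega)
    simp only [PICircuit.size, pre_body, List.length_take]
    have : min u B.length ≤ u := Nat.min_le_left _ _
    rw [hb] at hlt
    omega
  · intro γ
    rw [unfold_rename, hunf]
    exact acEq_rename_binTree_output hD γ (hy γ)
  · intro γ
    obtain ⟨π, hπ⟩ := hD γ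
    have hI := isIso_of_isAutomorphismExtending hπ
    have hout : π (D.output y) = D.output y := by
      have := hπ.output_smul y; rw [hy γ] at this; exact this.symm
    set M := (s + 3) * (B.length + 3) with hM
    have hM1 : 3 * B.length + 7 ≤ M := by rw [hM]; nlinarith
    have hM2 : s * (B.length + 2) ≤ M := by rw [hM]; nlinarith
    have hp := provable_gateLine (D := D) (ρ := fun x => γ • x) hfi hmono hPl hI hM1 hM2 (D.output y)
    rw [hout, ← pre_rename] at hp
    refine HasPCProofOfSize.mono hp ?_
    have hBl : B.length = s * s * (s + 2) := by rw [length_layoutBody P]; rfl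
    rw [hM, hBl]
    exact arith_final s

end PCR

open Literature.Computability.AlgebraicComplexity in
/-- **A symmetric circuit proves its own symmetry in `P_c(ℂ)`, in polynomial size** (registered
helper — the NECESSITY of stub T′ `stub_invarianceProvableQP'`, crux `RestorationQP`): an
`S_n`-symmetric Dawar–Wilsenach circuit over the matrix variables on a finite gate type `G` is
computed by a Hrubeš–Tzameret circuit of size `≤ |G|²(|G|+2)` all of whose invariance identities
`C ∘ σ = C` have `P_c(ℂ)` proofs of size `≤ 310·(|G|+3)⁹`. [folklore] -/
theorem invarianceProvableQP_aux_symmetricProves : ∀ (n : ℕ) (G : Type) [Fintype G] (D : LabelledArithCircuit ℂ (Fin n × Fin n) Unit G), D.IsSymmetric (Equiv.Perm (Fin n)) → ∃ C : PICircuit ℂ (Fin n × Fin n), C.eval = D.eval (D.output ()) ∧ C.size ≤ Fintype.card G * Fintype.card G * (Fintype.card G + 2) ∧ ∀ σ : Equiv.Perm (Fin n), HasPCProofOfSize (C.rename fun x : Fin n × Fin n => σ • x) C (310 * (Fintype.card G + 3) ^ 9) := by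
  intro n G _ D hD
  obtain ⟨C, -, hev, hsz, -, hpc⟩ := PCR.exists_piCircuit_pcProofs_of_isSymmetric (Γ := Equiv.Perm (Fin n)) D hD ()
    (fun _ => rfl)
  exact ⟨C, hev, hsz, hpc⟩

end Summit.ValiantsHypothesis.ValiantsHypothesis.Theorems

end
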